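import Summits.QuantumFields.YangMills.Theorems.InfiniteVolumeLatticeDistributions
import Literature.MathematicalPhysics.QuantumFieldTheory.SchwingerLimitInheritance
import HarnessLib

/-!
# Infinite volume by compactness, step 8: permutation symmetry (E3) of the string-SUM functionals of an
# infinite-volume state — exact on the lattice, inherited by the limits

HONEST FRAMING (cell `ym-fleet`, seat `ym-infvol-p2`, director-ym R136 (i) «INFINITE-VOLUME ∕ CONTINUUM-FROM-UV
ROUTE», pre-birth helper for support `IVData` of the planner's DESIGN 2026-08-26T17:44:53Z; bears on LADDER-YM
R1∕R2a).  Pure soft analysis, kernel-checked; no Yang–Mills input is consumed (no moment bound); nothing about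
Bałaban's renormalisation group, rotations, reflection positivity, uniqueness, a mass gap, or Clay.

WHY.  The route's one-field family is `S₁ n = Σ_{q valid} T n q` (`n ≥ 2`), `T n q` the limit of the plane-string
series `Σ'ₓ W_μ(q,x)·F(a·x_l + o(q_l))` with string-dependent offsets (plaquette CENTRES, the planner's DATA clause).
A single string functional is not symmetric under permutations of the arguments, but the SUM over all valid strings
is, EXACTLY at every lattice spacing: permuting the arguments of `F` by `π` is undone by re-indexing the multi-site
`x ↦ x ∘ π` and the string `q ↦ q ∘ π` simultaneously, and the centred product weight is invariant under that
simultaneous re-indexing.  E3 of the limit follows by uniqueness of limits.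

WHAT IS PROVED ([folklore] throughout).
* §1 `infVolWeight_perm` — `W_μ(q ∘ π, x ∘ π) = W_μ(q, x)` (re-indexing a finite product);
  **`tsum_weight_mul_permTest`** — for weights with that covariance and evaluation points `a·x_l + o(q_l)`:
  `Σ'ₓ W(q,x)·(permTest π F)(…q…) = Σ'ₓ W(q∘π,x)·F(…q∘π…)`; `sum_validStrings_comp_perm` (re-indexing the sum over
  valid strings by `q ↦ q ∘ π`); **`sum_tsum_weight_mul_permTest`** — the string-SUM functional is EXACTLY
  symmetric: `Σ_{q valid} Σ'ₓ W(q,x)·(permTest π F)(…) = Σ_{q valid} Σ'ₓ W(q,x)·F(…)`.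
* §2 **`sum_limit_permTest_eq`** — inheritance: if for `n ≥ 2`, every valid `q` and `F ∈ ⁰𝒮ₙ` the series of the
  states `μ_k` converge to `T n q F`, then `Σ_{q valid} T n q (permTest π F) = Σ_{q valid} T n q F` on `⁰𝒮ₙ`.

References: Osterwalder–Schrader CMP 31 (1973) §2 (E3); Glimm–Jaffe (1987) §6.1.
-/

set_option autoImplicit false

noncomputable section

open scoped BigOperators SchwartzMap
open MeasureTheory Filter Topology
open Literature.MathematicalPhysics.QuantumFieldTheory hiding ZdEdge
open Literature.MathematicalPhysics.QuantumLattice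
open Literature.MathematicalPhysics.AQFT
open Literature.Probability.LatticeModels (box Site)
open Summit.QuantumFields.YangMills.Cruxes.OSLegsFromFemtoAndGap.DlrCollarTransfer (plane)

namespace Summit.QuantumFields.YangMills.Theorems.InfiniteVolume

/-! ## §1 Exact symmetry of the string-sum functional on the lattice -/

section Lattice

variable {G : Type} [Group G] [TopologicalSpace G] [MeasurableSpace G]

/-- **Simultaneous re-indexing of string and sites leaves the centred product weight unchanged**:
`W_μ(q ∘ π, x ∘ π) = W_μ(q, x)`. [folklore] -/
theorem infVolWeight_perm (r : LatticeRep G) (μ : Measure (LGConfig 4 G)) {n : ℕ} (q : Fin n → Fin 4 × Fin 4)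
    (x : Fin n → Site 4) (π : Equiv.Perm (Fin n)) :
    ∫ U, ∏ i, (plane G r ((q ∘ π) i) ((x ∘ π) i) U - ∫ V, plane G r ((q ∘ π) i) ((x ∘ π) i) V ∂μ) ∂μ =
      ∫ U, ∏ i, (plane G r (q i) (x i) U - ∫ V, plane G r (q i) (x i) V ∂μ) ∂μ := by
  congr 1
  funext U
  exact Equiv.prod_comp π (fun i => plane G r (q i) (x i) U - ∫ V, plane G r (q i) (x i) V ∂μ)

end Lattice

section Abstract

variable {n : ℕ}

/-- **A single string functional under a permutation of the arguments**: for weights with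
`W (q ∘ π) (x ∘ π) = W q x` and evaluation points `a·x_l + o(q_l)`,
`Σ'ₓ W(q,x)·(permTest π F)(l ↦ a·x_l + o(q_l)) = Σ'ₓ W(q∘π, x)·F(l ↦ a·x_l + o((q∘π)_l))`. [folklore] -/
theorem tsum_weight_mul_permTest (W : (Fin n → Fin 4 × Fin 4) → (Fin n → Site 4) → ℝ) (π : Equiv.Perm (Fin n))
    (hW : ∀ q x, W (q ∘ π) (x ∘ π) = W q x) (a : ℝ) (o : Fin 4 × Fin 4 → EuclideanSpace ℝ (Fin 4))
    (q : Fin n → Fin 4 × Fin 4) (F : 𝓢((Fin n → EuclideanSpace ℝ (Fin 4)), ℂ)) :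
    ∑' x : Fin n → Site 4, ((W q x : ℝ) : ℂ) * permTest π F (fun l => a • siteToE (x l) + o (q l)) =
      ∑' x : Fin n → Site 4, ((W (q ∘ π) x : ℝ) : ℂ) * F (fun l => a • siteToE (x l) + o ((q ∘ π) l)) := by
  -- the re-indexing equivalence `x ↦ x ∘ π`
  let e : (Fin n → Site 4) ≃ (Fin n → Site 4) := Equiv.arrowCongr π.symm (Equiv.refl (Site 4))
  have he : ∀ x : Fin n → Site 4, e x = x ∘ π := fun x => by
    funext l
    simp [e, Equiv.arrowCongr_apply]
  have hre : ∀ x : Fin n → Site 4,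
      ((W q x : ℝ) : ℂ) * permTest π F (fun l => a • siteToE (x l) + o (q l)) =
        ((W (q ∘ π) (e x) : ℝ) : ℂ) * F (fun l => a • siteToE ((e x) l) + o ((q ∘ π) l)) := fun x => by
    rw [permTest_apply, he, ← hW q x]
    rfl
  simp_rw [hre]
  exact e.tsum_eq (fun y : Fin n → Site 4 => ((W (q ∘ π) y : ℝ) : ℂ) * F (fun l => a • siteToE (y l) + o ((q ∘ π) l)))

/-- Re-indexing the sum over valid plane strings by `q ↦ q ∘ π`. [folklore] -/
theorem sum_validStrings_comp_perm {M : Type*} [AddCommMonoid M] (π : Equiv.Perm (Fin n))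
    (f : (Fin n → Fin 4 × Fin 4) → M) :
    ∑ q ∈ Fintype.piFinset (fun _ : Fin n => Finset.univ.filter fun p : Fin 4 × Fin 4 => p.1 < p.2), f (q ∘ π) =
      ∑ q ∈ Fintype.piFinset (fun _ : Fin n => Finset.univ.filter fun p : Fin 4 × Fin 4 => p.1 < p.2), f q := by
  classical
  refine Finset.sum_nbij' (fun q => q ∘ π) (fun q => q ∘ π.symm) (fun q hq => ?_) (fun q hq => ?_)
    (fun q _ => ?_) (fun q _ => ?_) (fun q _ => rfl)
  · simp only [Fintype.mem_piFinset, Function.comp_apply] at hq ⊢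
    exact fun l => hq _
  · simp only [Fintype.mem_piFinset, Function.comp_apply] at hq ⊢
    exact fun l => hq _
  · funext l; simp
  · funext l; simp

/-- **THE STRING-SUM FUNCTIONAL IS EXACTLY SYMMETRIC.**  For weights with `W (q ∘ π) (x ∘ π) = W q x` for all
`π`, string-dependent offsets `o` and any Schwartz `F`:
`Σ_{q valid} Σ'ₓ W(q,x)·(permTest π F)(l ↦ a·x_l + o(q_l)) = Σ_{q valid} Σ'ₓ W(q,x)·F(l ↦ a·x_l + o(q_l))`. [folklore] -/
theorem sum_tsum_weight_mul_permTest (W : (Fin n → Fin 4 × Fin 4) → (Fin n → Site 4) → ℝ)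
    (hW : ∀ (π : Equiv.Perm (Fin n)) q x, W (q ∘ π) (x ∘ π) = W q x) (a : ℝ)
    (o : Fin 4 × Fin 4 → EuclideanSpace ℝ (Fin 4)) (π : Equiv.Perm (Fin n))
    (F : 𝓢((Fin n → EuclideanSpace ℝ (Fin 4)), ℂ)) :
    ∑ q ∈ Fintype.piFinset (fun _ : Fin n => Finset.univ.filter fun p : Fin 4 × Fin 4 => p.1 < p.2),
        ∑' x : Fin n → Site 4, ((W q x : ℝ) : ℂ) * permTest π F (fun l => a • siteToE (x l) + o (q l)) =
      ∑ q ∈ Fintype.piFinset (fun _ : Fin n => Finset.univ.filter fun p : Fin 4 × Fin 4 => p.1 < p.2),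
        ∑' x : Fin n → Site 4, ((W q x : ℝ) : ℂ) * F (fun l => a • siteToE (x l) + o (q l)) := by
  simp_rw [tsum_weight_mul_permTest W π (hW π) a o]
  exact sum_validStrings_comp_perm π
    (fun q => ∑' x : Fin n → Site 4, ((W q x : ℝ) : ℂ) * F (fun l => a • siteToE (x l) + o (q l)))

end Abstract

/-! ## §2 Inheritance by the limits -/

section Limit

variable {G : Type} [Group G] [TopologicalSpace G] [MeasurableSpace G]

/-- **E3 of the limit string-sum.**  States `μ_k`, scales `a_k`, string-dependent offsets `o k`, and limits `T n q`
with `Σ'ₓ W_{μ_k}(q,x)·F(a_k·x_l + o k (q_l)) → T n q F` for every valid `q` and `F ∈ ⁰𝒮ₙ` (`n ≥ 2` in the route;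
any `n` here): then `Σ_{q valid} T n q (permTest π F) = Σ_{q valid} T n q F` for `F ∈ ⁰𝒮ₙ`. [folklore] -/
theorem sum_limit_permTest_eq (r : LatticeRep G) (μ : ℕ → Measure (LGConfig 4 G)) (a : ℕ → ℝ)
    (o : ℕ → Fin 4 × Fin 4 → EuclideanSpace ℝ (Fin 4)) {n : ℕ}
    (T : (Fin n → Fin 4 × Fin 4) → 𝓢((Fin n → EuclideanSpace ℝ (Fin 4)), ℂ) → ℂ)
    (hconv : ∀ q : Fin n → Fin 4 × Fin 4, (∀ i, (q i).1 < (q i).2) →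
      ∀ F : 𝓢((Fin n → EuclideanSpace ℝ (Fin 4)), ℂ), IsOffDiagonal F →
        Tendsto (fun k => ∑' x : Fin n → Site 4,
          (((∫ U, ∏ i, (plane G r (q i) (x i) U - ∫ V, plane G r (q i) (x i) V ∂(μ k)) ∂(μ k) : ℝ) : ℂ)) *
            F (fun l => a k • siteToE (x l) + o k (q l))) atTop (𝓝 (T q F)))
    (π : Equiv.Perm (Fin n)) (F : 𝓢((Fin n → EuclideanSpace ℝ (Fin 4)), ℂ)) (hF : IsOffDiagonal F) :
    ∑ q ∈ Fintype.piFinset (fun _ : Fin n => Finset.univ.filter fun p : Fin 4 × Fin 4 => p.1 < p.2),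
        T q (permTest π F) =
      ∑ q ∈ Fintype.piFinset (fun _ : Fin n => Finset.univ.filter fun p : Fin 4 × Fin 4 => p.1 < p.2), T q F := by
  classical
  set P := Fintype.piFinset (fun _ : Fin n => Finset.univ.filter fun p : Fin 4 × Fin 4 => p.1 < p.2) with hP
  have hmemP : ∀ q, q ∈ P → ∀ i, (q i).1 < (q i).2 := fun q hq i => by
    rw [hP, Fintype.mem_piFinset] at hq
    exact (Finset.mem_filter.1 (hq i)).2
  -- the two finite sums of lattice functionals converge to the two sides
  have h1 : Tendsto (fun k => ∑ q ∈ P, ∑' x : Fin n → Site 4,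
      (((∫ U, ∏ i, (plane G r (q i) (x i) U - ∫ V, plane G r (q i) (x i) V ∂(μ k)) ∂(μ k) : ℝ) : ℂ)) *
        permTest π F (fun l => a k • siteToE (x l) + o k (q l))) atTop (𝓝 (∑ q ∈ P, T q (permTest π F))) :=
    tendsto_finsetSum _ fun q hq => hconv q (hmemP q hq) _ (hF.permTest π)
  have h2 : Tendsto (fun k => ∑ q ∈ P, ∑' x : Fin n → Site 4,
      (((∫ U, ∏ i, (plane G r (q i) (x i) U - ∫ V, plane G r (q i) (x i) V ∂(μ k)) ∂(μ k) : ℝ) : ℂ)) *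
        F (fun l => a k • siteToE (x l) + o k (q l))) atTop (𝓝 (∑ q ∈ P, T q F)) :=
    tendsto_finsetSum _ fun q hq => hconv q (hmemP q hq) F hF
  -- and they are equal for every `k`
  have heq : ∀ k, (∑ q ∈ P, ∑' x : Fin n → Site 4,
      (((∫ U, ∏ i, (plane G r (q i) (x i) U - ∫ V, plane G r (q i) (x i) V ∂(μ k)) ∂(μ k) : ℝ) : ℂ)) *
        permTest π F (fun l => a k • siteToE (x l) + o k (q l))) =
      ∑ q ∈ P, ∑' x : Fin n → Site 4,
      (((∫ U, ∏ i, (plane G r (q i) (x i) U - ∫ V, plane G r (q i) (x i) V ∂(μ k)) ∂(μ k) : ℝ) : ℂ)) *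
        F (fun l => a k • siteToE (x l) + o k (q l)) := fun k =>
    sum_tsum_weight_mul_permTest
      (fun q x => ∫ U, ∏ i, (plane G r (q i) (x i) U - ∫ V, plane G r (q i) (x i) V ∂(μ k)) ∂(μ k))
      (fun π' q x => infVolWeight_perm r (μ k) q x π') (a k) (o k) π F
  exact tendsto_nhds_unique (h1.congr heq) h2

end Limit

end Summit.QuantumFields.YangMills.Theorems.InfiniteVolume

end
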